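import Literature.NumberTheory.Automorphic.Liu2021.LemD1DataOfPlace
import Literature.NumberTheory.Automorphic.UnitaryGroupSymplecticCarriers
import Literature.NumberTheory.Automorphic.UnitaryGroupDirectSum
import Literature.NumberTheory.QuadraticForms.QuadraticFormIsotropicOfFiveLe
import Literature.NumberTheory.QuadraticForms.GlobalSquareTheorem
import Literature.NumberTheory.QuadraticForms.QuadraticExtensionPlaces
import Mathlib.LinearAlgebra.QuadraticForm.Prod
import Mathlib.LinearAlgebra.BilinearForm.Orthogonal
import Mathlib.Topology.NhdsWithin
import HarnessLib

/-!
# A rational «line ⊕ locally isotropic plane» frame for a ternary hermitian form `J = T ⊗ 1`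
# (piece R1d-i of route R for `rankOne_theta_twist_rigidity`, cell hodgecm-mathlib row IV-4c3)

Topic `RepresentationTheory/MoeglinVignerasWaldspurger1987` (consumer side); namespace
`Literature.RepresentationTheory.MoeglinVignerasWaldspurger1987.RationalHyperbolicFrame`.  KERNEL ONLY: theorems, no
definition, no named fact, no `sorry`.

**Setting.** `E/F` a quadratic extension of number fields with non-trivial automorphism `c`, `δ ∈ E` with `c δ = -δ ≠ 0`,
`v` a finite place of `F` which does NOT split in `E` (`E_v = E ⊗_F F_v` a field, `hE`), and a non-degenerate
`T ∈ Sym₃(F)` — the hermitian space `(E³, J = T ⊗ 1)` of the rank-one theta files (`LocalMp F 3 T v`, …).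

**Result** (`exists_rational_hyperbolic_frame`).  There are a RATIONAL `P ∈ GL₃(F)`, `t ∈ Sym₁(F)`, `T_H ∈ Sym₂(F)`,
both non-degenerate, with `Pᵀ T P = t ⊕ T_H` (`UnitaryGroup.finSum 1 2 t T_H`) and the hermitian PLANE
`(E_v², T_H ⊗ 1)` ISOTROPIC at `v` — in the tree's currency `LemD1.IsIsotropic (LemD1OfPlace.standingData E v c 2 (T_H ⊗ 1) …)`.
(A hermitian plane over the quadratic field extension `E_v/F_v` need not be isotropic — rank `3` is the sharp bound
of `HermitianLocalIsotropy` — so the plane has to be CHOSEN; the point is that it can be chosen RATIONALLY.)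

**Proof** (norm classes; [Omeara1963, §63C 63:17–63:19], [Jacobson1940HermitianForms, §3 (1)(a)]).  With `D = det T`:
1. (`exists_local_vector`) a LOCAL `x ∈ F_v³` with `T[x] = −D · N(z)`, `z = p + q δ ≠ 0`: the `5`-dimensional
   `F_v`-form `T ⊕ D⟨1, −δ²⟩` has a non-trivial zero (u-invariant `≤ 4`, tree
   `QuadraticForms.not_anisotropic_of_five_le_finrank_adicCompletion`); a zero with `(p, q) = 0` makes `T_v`
   isotropic, and then the hyperbolic pencil `μ x + y` takes the value `−D` exactly;
2. (`exists_rat_vector_mul_sq`) the local square theorem (`QuadraticForms.isSquare_of_valued_sub_one_lt`,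
   [Omeara1963, §63A 63:1b]) and the density of `F³` in `F_v³` give a RATIONAL `b` with `T[b] = T[x] · c²`, `c ≠ 0`;
3. (`exists_frame`, any field with `2 ≠ 0`) a rational `T`-orthogonal frame `(b, w₁, w₂)` (Mathlib
   `LinearMap.BilinForm.restrict_nondegenerate_orthogonal_spanSingleton`, `exists_orthogonal_basis`):
   `Pᵀ T P = diag(t, a₁, a₂)`, `t = T[b]`;
4. `t a₁ a₂ = (det P)² D` and `ι t = −ι D · N(z c)` make `(ι(t · det P), ι(a₁ t) · z c)` an isotropic vector of the
   hermitian plane `⟨a₁, a₂⟩` (a two-line identity; `E_v` a field is used once: `N(z) ≠ 0`).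

## Use
Cell `hodgecm-mathlib`, route R for [GelbartRogawski1991, §3 pp. 461–462] `rankOne_theta_twist_rigidity` (B-p03,
`R1-SPEC.md` §R1d-i): the hypothesis `RationalHyperbolicFrame₃` of `rankOne_theta_twist_rigidity_of_nonPeriodic₁₁`.
HC_CM is proved only modulo the printed citations until rung 0 of the ladder closes; nothing of them is asserted here.

## References
* [Omeara1963] O. T. O'Meara, *Introduction to Quadratic Forms* (1963), §63A Cor. 63:1b, §63C 63:17–63:19.
* [Jacobson1940HermitianForms] N. Jacobson, Bull. AMS 46 (1940), §3 (1)(a) (hermitian forms over 𝔭-adic fields).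
* [GelbartRogawski1991] S. Gelbart, J. Rogawski, Invent. Math. 105 (1991), §3 pp. 461–462 (the consumer).
-/

set_option autoImplicit false

noncomputable section

open scoped Matrix
open NumberField IsDedekindDomain
open Literature.NumberTheory.Automorphic Literature.NumberTheory.Automorphic.UnitaryGroup
open Literature.NumberTheory.Automorphic.Liu2021

namespace Literature.RepresentationTheory.MoeglinVignerasWaldspurger1987

namespace RationalHyperbolicFrame

/-! ## §1 Linear algebra: values of `T` on columns, symmetry, and the rational orthogonal frame -/

section Algebra

variable {K : Type*} [Field K]

/-- the entries of `Pᵀ T P` are the values `T(col_α P, col_β P)`. [folklore] -/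
private theorem transpose_mul_mul_apply {m n : Type*} [Fintype m] [Fintype n] (P : Matrix m n K) (T : Matrix m m K)
    (α β : n) : (Pᵀ * T * P) α β = (fun i => P i α) ⬝ᵥ (T *ᵥ fun j => P j β) := by
  simp only [Matrix.mul_apply, Matrix.transpose_apply, dotProduct, Matrix.mulVec, Finset.sum_mul, Finset.mul_sum]
  rw [Finset.sum_comm]
  exact Finset.sum_congr rfl fun i _ => Finset.sum_congr rfl fun j _ => by ring

/-- symmetry of the bilinear form of a symmetric matrix: `xᵀ T y = yᵀ T x`. [folklore] -/
private theorem dotProduct_mulVec_comm {n : Type*} [Fintype n] {R : Type*} [CommRing R] (T : Matrix n n R)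
    (hT : T.IsSymm) (x y : n → R) : x ⬝ᵥ (T *ᵥ y) = y ⬝ᵥ (T *ᵥ x) := by
  rw [Matrix.dotProduct_mulVec, ← Matrix.mulVec_transpose, hT.eq, dotProduct_comm]

/-- the quadratic expansion `T[μ x + y] = μ² T[x] + 2 μ (xᵀ T y) + T[y]` for symmetric `T`. [folklore] -/
private theorem dotProduct_mulVec_smul_add {n : Type*} [Fintype n] {R : Type*} [CommRing R] (T : Matrix n n R)
    (hT : T.IsSymm) (μ : R) (x y : n → R) :
    (μ • x + y) ⬝ᵥ (T *ᵥ (μ • x + y)) = μ ^ 2 * (x ⬝ᵥ (T *ᵥ x)) + 2 * μ * (x ⬝ᵥ (T *ᵥ y)) + y ⬝ᵥ (T *ᵥ y) := by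
  rw [Matrix.mulVec_add, Matrix.mulVec_smul, dotProduct_add, add_dotProduct, add_dotProduct, dotProduct_smul,
    dotProduct_smul, smul_dotProduct, smul_dotProduct, dotProduct_mulVec_comm T hT y x]
  simp only [smul_eq_mul]
  ring

/-- a ring homomorphism commutes with `b ↦ bᵀ T b`. [folklore] -/
private theorem map_dotProduct_mulVec {R S : Type*} [CommRing R] [CommRing S] (f : R →+* S) {n : Type*} [Fintype n]
    (T : Matrix n n R) (b : n → R) : f (b ⬝ᵥ (T *ᵥ b)) = (f ∘ b) ⬝ᵥ (T.map f *ᵥ (f ∘ b)) := by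
  rw [RingHom.map_dotProduct]
  congr 1
  funext i
  exact RingHom.map_mulVec f T b i

/-- **A rational `T`-orthogonal frame through a given anisotropic vector.**  `K` a field with `2` invertible,
`T ∈ Sym₃(K)` non-degenerate, `b` with `t := bᵀ T b ≠ 0`: there are `P ∈ M₃(K)` with `det P ≠ 0` and
`a₁, a₂ ≠ 0` with `Pᵀ T P = (t) ⊕ diag(a₁, a₂)` (`UnitaryGroup.finSum 1 2`).  (Columns `b, w₁, w₂` with `(w₁, w₂)` a
`T`-orthogonal basis of `b^⊥` — Mathlib `restrict_nondegenerate_orthogonal_spanSingleton`, `exists_orthogonal_basis`.)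
[cite: Omeara1963, §42D] -/
theorem exists_frame [Invertible (2 : K)] (T : Matrix (Fin 3) (Fin 3) K) (hT : T.IsSymm) (hTd : T.det ≠ 0)
    (b : Fin 3 → K) (hb : b ⬝ᵥ (T *ᵥ b) ≠ 0) :
    ∃ (P : Matrix (Fin 3) (Fin 3) K) (a : Fin 2 → K), P.det ≠ 0 ∧ (∀ k, a k ≠ 0) ∧
      Pᵀ * T * P = UnitaryGroup.finSum 1 2 (Matrix.diagonal fun _ => b ⬝ᵥ (T *ᵥ b)) (Matrix.diagonal a) := by
  classical
  -- the bilinear form of `T`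
  set B : LinearMap.BilinForm K (Fin 3 → K) := Matrix.toBilin' T with hBdef
  have hB : ∀ x y, B x y = x ⬝ᵥ (T *ᵥ y) := fun x y => Matrix.toBilin'_apply' T x y
  have hBs : B.IsSymm := Matrix.isSymm_toBilin'_iff_isSymm.2 hT
  have hBn : B.Nondegenerate := LinearMap.BilinForm.nondegenerate_toBilin'_of_det_ne_zero' T hTd
  have hbb : B b b ≠ 0 := by rwa [hB]
  have hb0 : b ≠ 0 := by
    rintro rfl
    exact hbb (by simp)
  -- `W = b^⊥`, a non-degenerate plane
  set W : Submodule K (Fin 3 → K) := B.orthogonal (K ∙ b) with hWdef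
  have hWn : (B.restrict W).Nondegenerate := B.restrict_nondegenerate_orthogonal_spanSingleton hBn hBs.isRefl hbb
  have hW2 : Module.finrank K W = 2 := by
    have h := Submodule.finrank_add_eq_of_isCompl (LinearMap.BilinForm.isCompl_span_singleton_orthogonal hbb)
    rw [← hWdef, finrank_span_singleton hb0, Module.finrank_fin_fun K] at h
    omega
  have hWs : (B.restrict W).IsSymm :=
    LinearMap.BilinForm.isSymm_def.2 fun x y => by
      rw [LinearMap.BilinForm.restrict_apply, LinearMap.BilinForm.restrict_apply]
      exact hBs.eq x y
  obtain ⟨w₀, hw₀⟩ := LinearMap.BilinForm.exists_orthogonal_basis (LinearMap.BilinForm.isSymm_iff.1 hWs)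
  set w : Module.Basis (Fin 2) K W := w₀.reindex (finCongr hW2) with hwdef
  have hwO : (B.restrict W).iIsOrtho w := by
    intro k l hkl
    have h : (B.restrict W) (w₀ ((finCongr hW2).symm k)) (w₀ ((finCongr hW2).symm l)) = 0 :=
      hw₀ (fun h => hkl ((finCongr hW2).symm.injective h))
    show (B.restrict W) (w k) (w l) = 0
    rw [hwdef, Module.Basis.reindex_apply, Module.Basis.reindex_apply]
    exact h
  -- the coefficients
  set a : Fin 2 → K := fun k => B (w k) (w k) with hadef
  have ha : ∀ k, a k ≠ 0 := fun k => by
    have h := hwO.not_isOrtho_basis_self_of_nondegenerate hWn k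
    rwa [LinearMap.BilinForm.restrict_apply] at h
  have hw : ∀ k l, k ≠ l → B (w k) (w l) = 0 := fun k l hkl => by
    have h : (B.restrict W) (w k) (w l) = 0 := hwO hkl
    rwa [LinearMap.BilinForm.restrict_apply] at h
  have hbw : ∀ k, B b (w k) = 0 := fun k => by
    have hmem : ((w k : W) : Fin 3 → K) ∈ B.orthogonal (K ∙ b) := by
      rw [← hWdef]
      exact (w k).2
    rw [LinearMap.BilinForm.mem_orthogonal_iff] at hmem
    exact hmem b (Submodule.mem_span_singleton_self b)
  have hwb : ∀ k, B (w k) b = 0 := fun k => by rw [hBs.eq]; exact hbw k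
  -- the frame matrix: columns `b, w 0, w 1` along `e : Fin 1 ⊕ Fin 2 ≃ Fin 3`
  set e : Fin 1 ⊕ Fin 2 ≃ Fin 3 := finSumFinEquiv with he
  set P : Matrix (Fin 3) (Fin 3) K := Matrix.of fun i j =>
    Sum.elim (fun _ : Fin 1 => b i) (fun k : Fin 2 => ((w k : W) : Fin 3 → K) i) (e.symm j) with hPdef
  have hcol₁ : ∀ α : Fin 1, (fun i => P i (e (Sum.inl α))) = b := fun α => by
    funext i
    simp only [hPdef, Matrix.of_apply, Equiv.symm_apply_apply, Sum.elim_inl]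
  have hcol₂ : ∀ k : Fin 2, (fun i => P i (e (Sum.inr k))) = ((w k : W) : Fin 3 → K) := fun k => by
    funext i
    simp only [hPdef, Matrix.of_apply, Equiv.symm_apply_apply, Sum.elim_inr]
  have hsub : (Pᵀ * T * P).submatrix e e =
      Matrix.fromBlocks (Matrix.diagonal fun _ => b ⬝ᵥ (T *ᵥ b)) 0 0 (Matrix.diagonal a) := by
    ext α β
    rw [Matrix.submatrix_apply, transpose_mul_mul_apply]
    rcases α with α | k <;> rcases β with β | l
    · obtain rfl : α = β := Subsingleton.elim _ _
      rw [hcol₁, Matrix.fromBlocks_apply₁₁, Matrix.diagonal_apply_eq]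
    · rw [hcol₁, hcol₂, Matrix.fromBlocks_apply₁₂, Matrix.zero_apply, ← hB]
      exact hbw l
    · rw [hcol₂, hcol₁, Matrix.fromBlocks_apply₂₁, Matrix.zero_apply, ← hB]
      exact hwb k
    · rw [hcol₂, hcol₂, Matrix.fromBlocks_apply₂₂, ← hB]
      by_cases hkl : k = l
      · subst hkl
        rw [Matrix.diagonal_apply_eq]
      · rw [Matrix.diagonal_apply_ne _ hkl]
        exact hw k l hkl
  have heq : Pᵀ * T * P = UnitaryGroup.finSum 1 2 (Matrix.diagonal fun _ => b ⬝ᵥ (T *ᵥ b)) (Matrix.diagonal a) := by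
    rw [UnitaryGroup.finSum, Matrix.reindex_apply, ← hsub, Matrix.submatrix_submatrix, he, Equiv.self_comp_symm,
      Matrix.submatrix_id_id]
  -- `det P ≠ 0` from the determinant of the frame identity
  have hdet : P.det * T.det * P.det = (b ⬝ᵥ (T *ᵥ b)) * (a 0 * a 1) := by
    have h := congrArg Matrix.det heq
    rw [Matrix.det_mul, Matrix.det_mul, Matrix.det_transpose, UnitaryGroup.finSum, Matrix.det_reindex_self,
      Matrix.det_fromBlocks_zero₂₁, Matrix.det_diagonal, Matrix.det_diagonal, Fin.prod_univ_one,
      Fin.prod_univ_two] at h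
    rw [← h]
  have hP : P.det ≠ 0 := by
    intro h0
    rw [h0, zero_mul, zero_mul] at hdet
    exact mul_ne_zero hb (mul_ne_zero (ha 0) (ha 1)) hdet.symm
  exact ⟨P, a, hP, ha, heq⟩

end Algebra

/-! ## §2 The local vector: `T[x] = −D · (p² − e q²)` with `(p, q) ≠ 0` (u-invariant `≤ 4`) -/

section Local

variable (K : Type) [Field K] [NumberField K] (v : HeightOneSpectrum (𝓞 K))

/-- **Local vector of prescribed norm class.**  Over `K_v` (`v` finite), for `T ∈ Sym₃(K_v)` non-degenerate and
`D, e ∈ K_v`: there are `x ∈ K_v³` and `(p, q) ≠ (0, 0)` with `xᵀ T x = −D (p² − e q²)`.  The `5`-dimensional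
form `T ⊕ ⟨D, −D e⟩` is isotropic (u-invariant of `K_v` is `4`); a zero with `(p, q) = 0` is an isotropic vector of `T`,
and then the hyperbolic pencil through it represents `−D` on the nose. [cite: Omeara1963, §63C 63:17–63:19] -/
theorem exists_local_vector (T : Matrix (Fin 3) (Fin 3) (v.adicCompletion K)) (hT : T.IsSymm) (hTd : T.det ≠ 0)
    (D e : v.adicCompletion K) :
    ∃ (x : Fin 3 → v.adicCompletion K) (p q : v.adicCompletion K), (p ≠ 0 ∨ q ≠ 0) ∧
      x ⬝ᵥ (T *ᵥ x) = -D * (p ^ 2 - e * q ^ 2) := by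
  classical
  haveI : CharZero (v.adicCompletion K) :=
    charZero_of_injective_algebraMap (algebraMap K (v.adicCompletion K)).injective
  -- the quinary form `Q(x, (p, q)) = xᵀ T x + D p² − D e q²`
  let Q : QuadraticForm (v.adicCompletion K) ((Fin 3 → v.adicCompletion K) × (v.adicCompletion K × v.adicCompletion K)) :=
    (Matrix.toBilin' T).toQuadraticMap.prod ((D • QuadraticMap.sq).prod ((-(D * e)) • QuadraticMap.sq))
  have hQ : ∀ x p q, Q (x, (p, q)) = x ⬝ᵥ (T *ᵥ x) + (D * (p * p) + -(D * e) * (q * q)) := fun x p q => by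
    simp only [Q, QuadraticMap.prod_apply, LinearMap.BilinMap.toQuadraticMap_apply, Matrix.toBilin'_apply',
      QuadraticMap.smul_apply, QuadraticMap.sq_apply, smul_eq_mul]
  have h5 : 5 ≤ Module.finrank (v.adicCompletion K)
      ((Fin 3 → v.adicCompletion K) × (v.adicCompletion K × v.adicCompletion K)) := by
    rw [Module.finrank_prod, Module.finrank_prod, Module.finrank_fintype_fun_eq_card, Fintype.card_fin,
      Module.finrank_self]
  have hQa := Literature.NumberTheory.QuadraticForms.not_anisotropic_of_five_le_finrank_adicCompletion K v Q h5
  simp only [QuadraticMap.Anisotropic, not_forall] at hQa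
  obtain ⟨⟨x, p, q⟩, hz, hne⟩ := hQa
  rw [hQ] at hz
  by_cases hpq : p ≠ 0 ∨ q ≠ 0
  · exact ⟨x, p, q, hpq, by linear_combination hz⟩
  · push Not at hpq
    obtain ⟨rfl, rfl⟩ := hpq
    have hx0 : x ≠ 0 := by
      rintro rfl
      exact hne rfl
    have hxx : x ⬝ᵥ (T *ᵥ x) = 0 := by simpa using hz
    have hTx : T *ᵥ x ≠ 0 := fun h => hx0 (Matrix.eq_zero_of_mulVec_eq_zero hTd h)
    obtain ⟨i, hi⟩ := Function.ne_iff.1 hTx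
    have hi' : (T *ᵥ x) i ≠ 0 := by simpa using hi
    set y : Fin 3 → v.adicCompletion K := Pi.single i 1 with hy
    have hxy : x ⬝ᵥ (T *ᵥ y) = (T *ᵥ x) i := by
      rw [dotProduct_mulVec_comm T hT x y, hy, single_one_dotProduct]
    refine ⟨((-D - y ⬝ᵥ (T *ᵥ y)) / (2 * (T *ᵥ x) i)) • x + y, 1, 0, Or.inl one_ne_zero, ?_⟩
    rw [dotProduct_mulVec_smul_add T hT, hxx, hxy, mul_zero, zero_add]
    have h : 2 * ((-D - y ⬝ᵥ (T *ᵥ y)) / (2 * (T *ᵥ x) i)) * (T *ᵥ x) i = -D - y ⬝ᵥ (T *ᵥ y) := by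
      field_simp
    rw [h]
    ring

/-- **Rational vector in a local square class of values.**  For `x ∈ K_v³` with `xᵀ T x ≠ 0` there is a RATIONAL
`b ∈ K³` with `bᵀ T b = (xᵀ T x) · c²`, `c ∈ K_vˣ`: the squares of `K_v` contain a neighbourhood of `1`
(`QuadraticForms.isSquare_of_valued_sub_one_lt`, [Omeara1963, §63A 63:1b]), `y ↦ yᵀ T y` is continuous, and `K³` is
dense in `K_v³`. [cite: Omeara1963, §63A Cor. 63:1b] -/
theorem exists_rat_vector_mul_sq (T : Matrix (Fin 3) (Fin 3) (v.adicCompletion K)) (x : Fin 3 → v.adicCompletion K)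
    (hx : x ⬝ᵥ (T *ᵥ x) ≠ 0) :
    ∃ (b : Fin 3 → K) (c : v.adicCompletion K), c ≠ 0 ∧
      (fun i => algebraMap K (v.adicCompletion K) (b i)) ⬝ᵥ (T *ᵥ fun i => algebraMap K (v.adicCompletion K) (b i)) =
        x ⬝ᵥ (T *ᵥ x) * c ^ 2 := by
  classical
  haveI : CharZero (v.adicCompletion K) :=
    charZero_of_injective_algebraMap (algebraMap K (v.adicCompletion K)).injective
  set s₀ : v.adicCompletion K := x ⬝ᵥ (T *ᵥ x) with hs₀
  let f : (Fin 3 → v.adicCompletion K) → v.adicCompletion K := fun y => y ⬝ᵥ (T *ᵥ y)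
  have hf : Continuous f := by
    change Continuous fun y : Fin 3 → v.adicCompletion K => ∑ i, y i * ∑ j, T i j * y j
    fun_prop
  have h4 : (4 : v.adicCompletion K) ≠ 0 := by norm_num
  have h4s : (4 : v.adicCompletion K) * s₀ ≠ 0 := mul_ne_zero h4 hx
  -- the open set of vectors whose value is `s₀ · (1 + 4𝔪)`
  set O : Set (v.adicCompletion K) := {z | Valued.v (z - s₀) < Valued.v ((4 : v.adicCompletion K) * s₀)} with hO
  have hOo : IsOpen O := by
    have h1 := Valued.isOpen_ball (v.adicCompletion K) (Valued.v.restrict ((4 : v.adicCompletion K) * s₀))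
    have h2 : O = (fun z => z - s₀) ⁻¹'
        {z : v.adicCompletion K | Valued.v.restrict z < Valued.v.restrict ((4 : v.adicCompletion K) * s₀)} := by
      ext z
      simp only [hO, Set.mem_setOf_eq, Set.mem_preimage, Valuation.restrict_lt_iff]
    rw [h2]
    exact h1.preimage (continuous_sub_right s₀)
  have hxO : f x ∈ O := by
    show Valued.v (x ⬝ᵥ (T *ᵥ x) - s₀) < _
    rw [hs₀, sub_self, map_zero]
    exact (Valuation.pos_iff _).2 h4s
  obtain ⟨b, hb⟩ := (DenseRange.piMap fun _ : Fin 3 => HeightOneSpectrum.denseRange_algebraMap K v).mem_nhds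
    ((hOo.preimage hf).mem_nhds hxO)
  -- the value at `b` is `s₀ q` with `q ≡ 1 (mod 4)`, a square
  set s : v.adicCompletion K := f (Pi.map (fun _ : Fin 3 => algebraMap K (v.adicCompletion K)) b) with hs
  have hsO : Valued.v (s - s₀) < Valued.v ((4 : v.adicCompletion K) * s₀) := hb
  have hq : Valued.v (s / s₀ - 1) < Valued.v (4 : v.adicCompletion K) := by
    have h : s / s₀ - 1 = (s - s₀) / s₀ := by field_simp
    rw [h, map_div₀, div_lt_iff₀ ((Valuation.pos_iff _).2 hx), ← map_mul]
    exact hsO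
  obtain ⟨c, hc⟩ := Literature.NumberTheory.QuadraticForms.isSquare_of_valued_sub_one_lt K v hq
  have hsc : s = s₀ * c ^ 2 := by
    have h : s = s₀ * (s / s₀) := by field_simp
    rw [h, hc]; ring
  have hc0 : c ≠ 0 := by
    rintro rfl
    have h0 : s = 0 := by rw [hsc]; ring
    rw [h0, zero_sub, Valuation.map_neg, map_mul] at hsO
    have h4v : Valued.v (4 : v.adicCompletion K) ≤ 1 := by
      rw [show (4 : v.adicCompletion K) = 2 * 2 by norm_num, map_mul]
      exact mul_le_one' (Literature.NumberTheory.QuadraticForms.valued_two_le_one _)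
        (Literature.NumberTheory.QuadraticForms.valued_two_le_one _)
    exact (lt_irrefl _) (hsO.trans_le (mul_le_of_le_one_left' h4v))
  exact ⟨b, c, hc0, hsc⟩

end Local

/-! ## §3 The isotropic vector of a diagonal hermitian plane, and the assembly -/

section Assembly

variable (F E : Type) [Field F] [NumberField F] [Field E] [NumberField E] [Algebra F E]
  [Algebra.IsQuadraticExtension F E] (c : E ≃ₐ[F] E) {δ : E} (hcδ : c δ = -δ) (hδ : δ ≠ 0)
  (v : HeightOneSpectrum (𝓞 F))

omit [NumberField F] [NumberField E] [Algebra.IsQuadraticExtension F E] in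
/-- the diagonal matrix `diag(a) ⊗ 1 ∈ M₂(E)` is `c`-hermitian. [folklore] -/
private theorem diagonal_map_hermitian (a : Fin 2 → F) :
    (((Matrix.diagonal a).map (algebraMap F E)).map c)ᵀ = (Matrix.diagonal a).map (algebraMap F E) := by
  rw [Matrix.diagonal_map (map_zero _), Matrix.diagonal_map (map_zero _), Matrix.diagonal_transpose]
  congr 1
  funext k
  exact c.commutes (a k)

omit [NumberField F] [NumberField E] [Algebra.IsQuadraticExtension F E] in
/-- the diagonal matrix `diag(a) ⊗ 1 ∈ M₂(E)` is non-degenerate when `a₁ a₂ ≠ 0`. [folklore] -/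
private theorem diagonal_map_det_ne_zero (a : Fin 2 → F) (ha : ∀ k, a k ≠ 0) :
    ((Matrix.diagonal a).map (algebraMap F E)).det ≠ 0 := by
  rw [Matrix.diagonal_map (map_zero _), Matrix.det_diagonal]
  exact Finset.prod_ne_zero_iff.2 fun k _ => (map_ne_zero _).2 (ha k)

/-- **Isotropic vector of a diagonal hermitian plane with a norm relation.**  On the local model `E_v = E ⊗_F F_v`
with conjugation `c ⊗ 1`, for `a₁, a₂, t, π ∈ F`, `D ∈ F`, `z ∈ E_v` with `ι t = −ι D · z z̄` and
`t a₁ a₂ = π² D` — the shape produced by §1–§2 — the vector `(ι(t π), ι(a₁ t) z)` is isotropic for the hermitian form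
with Gram matrix `diag(a₁, a₂) ⊗ 1` (in the tree's `LemD1.IsIsotropic (LemD1OfPlace.standingData …)` currency), provided
`t π ≠ 0`. [cite: Jacobson1940HermitianForms, §3 (1)(a)] -/
theorem isIsotropic_standingData_diagonal (a : Fin 2 → F) (ha : ∀ k, a k ≠ 0) (t π D : F) (htπ : t * π ≠ 0)
    (hR : t * (a 0 * a 1) = π * D * π) (z : LocalRing E v)
    (hN : toLocalRing E v (algebraMap F _ t) = -toLocalRing E v (algebraMap F _ D) * (z * conjLocal E c v z)) :
    LemD1.IsIsotropic (LemD1OfPlace.standingData E v c 2 ((Matrix.diagonal a).map (algebraMap F E)) hcδ hδ (le_refl 2)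
      (diagonal_map_hermitian F E c a) (diagonal_map_det_ne_zero F E a ha)) := by
  classical
  set φ : F →+* LocalRing E v := (toLocalRing E v).comp (algebraMap F (v.adicCompletion F)) with hφ
  have hφc : ∀ r, conjLocal E c v (φ r) = φ r := fun r => conjLocal_toLocalRing c v _
  refine ⟨![φ (t * π), φ (a 0 * t) * z], ?_, ?_⟩
  · intro h
    have h0 := congrFun h 0
    simp only [Matrix.cons_val_zero, Pi.zero_apply] at h0
    exact htπ ((map_eq_zero_iff φ ((toLocalRing_injective E v).comp (algebraMap F (v.adicCompletion F)).injective)).1 h0)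
  · -- the Gram matrix of the standing datum is `diag(φ ∘ a)`
    have hgram : (LemD1OfPlace.standingData E v c 2 ((Matrix.diagonal a).map (algebraMap F E)) hcδ hδ (le_refl 2)
        (diagonal_map_hermitian F E c a) (diagonal_map_det_ne_zero F E a ha)).gram = Matrix.diagonal (φ ∘ a) := by
      rw [LemD1OfPlace.standingData_gram, localForm_eq_map E 2 v (Matrix.diagonal a) rfl,
        Matrix.diagonal_map (map_zero _), Matrix.diagonal_map (map_zero _)]
      rfl
    rw [Literature.RepresentationTheory.Liu2021.OscillatorStandingData.form,
      Literature.AlgebraicGeometry.ShimuraVarieties.hermForm, hgram]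
    have hσ : ∀ x, (LemD1OfPlace.standingData E v c 2 ((Matrix.diagonal a).map (algebraMap F E)) hcδ hδ (le_refl 2)
        (diagonal_map_hermitian F E c a) (diagonal_map_det_ne_zero F E a ha)).σ x = conjLocal E c v x := fun x => rfl
    simp only [dotProduct, Fin.sum_univ_two, Function.comp_apply, Matrix.mulVec_diagonal, hσ, Matrix.cons_val_zero,
      Matrix.cons_val_one, map_mul, hφc]
    have hR' : φ t * (φ (a 0) * φ (a 1)) = φ π * φ D * φ π := by
      rw [← map_mul, ← map_mul, ← map_mul, ← map_mul, hR]
    have hN' : φ t = -φ D * (z * conjLocal E c v z) := hN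
    linear_combination (φ (a 0) * φ t * (z * conjLocal E c v z)) * hR' +
      (φ (a 0) * φ t * φ π ^ 2) * hN'

include hcδ hδ in
omit [NumberField F] [Algebra.IsQuadraticExtension F E] in
/-- `c ≠ 1` when `c δ = -δ ≠ 0`. [folklore] -/
private theorem algEquiv_ne_one : c ≠ 1 := by
  rintro rfl
  exact hδ (CharZero.eq_neg_self_iff.1 (by simpa using hcδ))

/-- **R1d-i — a rational «line ⊕ locally isotropic plane» frame.**  `E/F` quadratic with `c δ = -δ ≠ 0`, `v` a finite
place of `F` with `E_v = E ⊗_F F_v` a field, `T ∈ Sym₃(F)` non-degenerate.  Then there are `P ∈ GL₃(F)`,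
`t ∈ Sym₁(F)`, `T_H ∈ Sym₂(F)`, both non-degenerate, with `Pᵀ T P = t ⊕ T_H` and the hermitian plane `(E_v², T_H ⊗ 1)`
ISOTROPIC (`LemD1.IsIsotropic` of the standing datum `LemD1OfPlace.standingData E v c 2 (T_H ⊗ 1) …`).
[cite: Omeara1963, §63C 63:17–63:19] [cite: Jacobson1940HermitianForms, §3 (1)(a)] -/
theorem exists_rational_hyperbolic_frame (hE : IsField (LocalRing E v)) (T : Matrix (Fin 3) (Fin 3) F)
    (hT : T.IsSymm) (hTd : IsUnit T.det) :
    ∃ (P : GL (Fin 3) F) (t : Matrix (Fin 1) (Fin 1) F) (T_H : Matrix (Fin 2) (Fin 2) F)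
      (hJh : ((T_H.map (algebraMap F E)).map c)ᵀ = T_H.map (algebraMap F E)) (hJdet : (T_H.map (algebraMap F E)).det ≠ 0),
      (P : Matrix (Fin 3) (Fin 3) F)ᵀ * T * P = UnitaryGroup.finSum 1 2 t T_H ∧ t.IsSymm ∧ T_H.IsSymm ∧
        IsUnit t.det ∧ IsUnit T_H.det ∧
        LemD1.IsIsotropic (LemD1OfPlace.standingData E v c 2 (T_H.map (algebraMap F E)) hcδ hδ (le_refl 2) hJh hJdet) := by
  classical
  haveI : Invertible (2 : F) := invertibleOfNonzero two_ne_zero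
  -- `δ² = d ∈ F`
  obtain ⟨d, hd⟩ := Literature.NumberTheory.QuadraticForms.QuadraticExtension.exists_algebraMap_eq_of_fixed
    (algEquiv_ne_one F E c hcδ hδ)
    (x := δ * δ) (by rw [map_mul, hcδ]; ring)
  -- §2: the local vector for `T_v`, `D = det T`
  have hcoe : ∀ r : F, toLocalRing E v (algebraMap F (v.adicCompletion F) r) = algebraMap E (LocalRing E v) (algebraMap F E r) :=
    fun r => toLocalRing_coe E v r
  set Tv : Matrix (Fin 3) (Fin 3) (v.adicCompletion F) := T.map (algebraMap F (v.adicCompletion F)) with hTv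
  have hTv_symm : Tv.IsSymm := hT.map _
  have hDv : algebraMap F (v.adicCompletion F) T.det ≠ 0 := (map_ne_zero _).2 hTd.ne_zero
  have hTv_det : Tv.det ≠ 0 := by
    have h : Tv.det = algebraMap F (v.adicCompletion F) T.det := by
      rw [hTv, RingHom.map_det, RingHom.mapMatrix_apply]
    rw [h]
    exact hDv
  obtain ⟨x, p, q, hpq, hx⟩ := exists_local_vector F v Tv hTv_symm hTv_det
    (algebraMap F (v.adicCompletion F) T.det) (algebraMap F (v.adicCompletion F) d)
  -- the norm `N(p + q δ) = p² − d q² ≠ 0` (`E_v` a field)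
  set z₀ : LocalRing E v := toLocalRing E v p + toLocalRing E v q * algebraMap E (LocalRing E v) δ with hz₀
  have hz₀0 : z₀ ≠ 0 := by
    intro h
    have h' : quadraticLocalMap E v δ (p, q) = quadraticLocalMap E v δ 0 := by
      rw [quadraticLocalMap_apply, map_zero]; exact h
    have h'' := quadraticLocalMap_injective E v c hcδ hδ h'
    simp only [Prod.mk_eq_zero] at h''
    rcases hpq with hp | hq'
    · exact hp h''.1
    · exact hq' h''.2
  have hδv : algebraMap E (LocalRing E v) δ * algebraMap E (LocalRing E v) δ =
      toLocalRing E v (algebraMap F (v.adicCompletion F) d) := by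
    rw [← map_mul, ← hd]
    exact (hcoe d).symm
  have hNz₀ : z₀ * conjLocal E c v z₀ = toLocalRing E v (p ^ 2 - algebraMap F _ d * q ^ 2) := by
    rw [hz₀, map_add, map_mul, conjLocal_toLocalRing, conjLocal_toLocalRing, conjLocal_algebraMap, hcδ, map_neg,
      map_sub, map_pow, map_mul, map_pow, ← hδv]
    ring
  have hN0 : p ^ 2 - algebraMap F _ d * q ^ 2 ≠ 0 := by
    intro h0
    letI := hE.toField
    have h1 : z₀ * conjLocal E c v z₀ ≠ 0 :=
      mul_ne_zero hz₀0 (fun h => hz₀0 (by simpa using congrArg (conjLocal E c v) h))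
    rw [hNz₀, h0, map_zero] at h1
    exact h1 rfl
  have hx0 : x ⬝ᵥ (Tv *ᵥ x) ≠ 0 := by
    rw [hx]
    exact mul_ne_zero (neg_ne_zero.2 hDv) hN0
  -- §2: a rational `b` in the same square class of values
  obtain ⟨b, cc, hcc, hb⟩ := exists_rat_vector_mul_sq F v Tv x hx0
  set t : F := b ⬝ᵥ (T *ᵥ b) with htdef
  have htv : algebraMap F (v.adicCompletion F) t = x ⬝ᵥ (Tv *ᵥ x) * cc ^ 2 := by
    rw [htdef, map_dotProduct_mulVec]
    exact hb
  have ht0 : t ≠ 0 := by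
    intro h0
    rw [h0, map_zero] at htv
    exact mul_ne_zero hx0 (pow_ne_zero 2 hcc) htv.symm
  -- §1: the rational frame
  obtain ⟨P, a, hP, ha, heq⟩ := exists_frame T hT hTd.ne_zero b ht0
  have hdet : P.det * T.det * P.det = t * (a 0 * a 1) := by
    have h := congrArg Matrix.det heq
    rw [Matrix.det_mul, Matrix.det_mul, Matrix.det_transpose, UnitaryGroup.finSum, Matrix.det_reindex_self,
      Matrix.det_fromBlocks_zero₂₁, Matrix.det_diagonal, Matrix.det_diagonal, Fin.prod_univ_one,
      Fin.prod_univ_two] at h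
    rw [h]
  -- §3: the isotropic vector, with `z = z₀ · ι cc`
  have hN : toLocalRing E v (algebraMap F _ t) =
      -toLocalRing E v (algebraMap F _ T.det) * ((z₀ * toLocalRing E v cc) * conjLocal E c v (z₀ * toLocalRing E v cc)) := by
    rw [htv, hx]
    simp only [map_mul, map_neg, map_pow, conjLocal_toLocalRing]
    rw [← hNz₀]
    ring
  refine ⟨Matrix.GeneralLinearGroup.mkOfDetNeZero P hP, Matrix.diagonal fun _ => t, Matrix.diagonal a,
    diagonal_map_hermitian F E c a, diagonal_map_det_ne_zero F E a ha, heq, Matrix.isSymm_diagonal _,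
    Matrix.isSymm_diagonal _, ?_, ?_, ?_⟩
  · rw [Matrix.det_diagonal, Fin.prod_univ_one]
    exact isUnit_iff_ne_zero.2 ht0
  · rw [Matrix.det_diagonal, Fin.prod_univ_two]
    exact isUnit_iff_ne_zero.2 (mul_ne_zero (ha 0) (ha 1))
  · exact isIsotropic_standingData_diagonal F E c hcδ hδ v a ha t P.det T.det (mul_ne_zero ht0 hP)
      hdet.symm (z₀ * toLocalRing E v cc) hN

end Assembly

end RationalHyperbolicFrame

end Literature.RepresentationTheory.MoeglinVignerasWaldspurger1987

end
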